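import Summits.CriticalPhenomena.PercolationContinuityZ3.Theorems.Transplant.FKConnectivityAllQWheelAutomaton
import HarnessLib

/-!
# Connectivity correlation inequalities for `φ_{w,q}` — the three-apex family: STARS AT FRESH VERTICES (cluster counts and reachability)

Support file (`--supports stmt-CriticalPhenomena-4575`), FK sub-lane `prim-bschramm-fk-3` (gen 12); builds on p205010 (kernel theorem, internal audit
signed; external expert review pending).  Pure finite graph theory (no measures); no named facts, no sorries; standard axioms.  Layer 2a of the
`K_{1,1,1,n}` programme (memo `bschramm/prim-bschramm-fk-3/THREE-APEX.md` §6): the configurations of `K_{1,1,1,n}` are built LEAF BY LEAF, each leaf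
`u` contributing the star `{s(x,u) : x ∈ A}` of its attachment set `A ⊆ {a,b,c}` at a vertex met by no earlier pair.  This file proves the two facts the
rigid-interpolation bridge needs about such a step, for an ARBITRARY finite configuration `ω` and an arbitrary attachment set `A`:
* **`reachable_union_star`** — for `y, z ≠ u`: `y ↔ z` in `ω ∪ star u A` iff `y ↔ z` in `ω`, or `y ↔ x` and `x' ↔ z` in `ω` for some `x, x' ∈ A`;
  and `y ↔ u` iff `y ↔ x` in `ω` for some `x ∈ A`;
* **`clusterCount_union_star_insert`** — adding one more ray `s(x,u)` (`x ∉ A`) lowers the cluster count by one unless `x` is already joined in `ω`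
  to some `x' ∈ A` (for `A = ∅`: always by one — the fresh vertex stops being a singleton cluster).
Tools: `FK.Wheel.reachable_coe_insert_iff`, `FK.Wheel.clusterCount_insert_free`, `FK.Wheel.not_reachable_of_fresh` (gen 8).
[cite: Grimmett2006, §1.2 eq. (1.1) (p. 4)] [folklore]
-/

noncomputable section

namespace Summit.CriticalPhenomena.PercolationContinuityZ3.Theorems

namespace FK

namespace ThreeApex

open Literature.Probability.LatticeModels Literature.Probability.Percolation
open scoped Classical

variable {V : Type*} [Fintype V] [DecidableEq V]

/-- The star of rays `s(x, u)`, `x ∈ A`, at the vertex `u`. [folklore] -/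
def star (u : V) (A : Finset V) : Finset (Sym2 V) := A.image fun x => s(x, u)

omit [Fintype V] in
/-- `star u ∅ = ∅`. [folklore] -/
@[simp] theorem star_empty (u : V) : star u (∅ : Finset V) = ∅ := by simp [star]

omit [Fintype V] in
/-- `star u (insert x A) = insert s(x,u) (star u A)`. [folklore] -/
theorem star_insert (u x : V) (A : Finset V) : star u (insert x A) = insert s(x, u) (star u A) := by
  simp [star, Finset.image_insert]

omit [Fintype V] in
/-- `ω ∪ star u (insert x A) = insert s(x,u) (ω ∪ star u A)`. [folklore] -/
theorem union_star_insert (ω : Finset (Sym2 V)) (u x : V) (A : Finset V) :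
    ω ∪ star u (insert x A) = insert s(x, u) (ω ∪ star u A) := by
  rw [star_insert, Finset.union_insert]

omit [Fintype V] in
/-- Every pair of `ω ∪ star u A` avoiding `u`… no: every pair of the star contains `u`; a vertex `w ≠ u` outside `A` met by no pair of `ω` is met
by no pair of `ω ∪ star u A`. [folklore] -/
theorem fresh_union_star {ω : Finset (Sym2 V)} {u w : V} (A : Finset V) (hw : ∀ e ∈ ω, w ∉ e) (hwu : w ≠ u) (hwA : w ∉ A) :
    ∀ e ∈ ω ∪ star u A, w ∉ e := by
  intro e he
  rcases Finset.mem_union.1 he with h | h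
  · exact hw e h
  · obtain ⟨x, hx, rfl⟩ := Finset.mem_image.1 h
    rw [Sym2.mem_iff, not_or]
    exact ⟨fun h => hwA (h ▸ hx), hwu⟩

omit [Fintype V] in
/-- **Reachability after adding a star at a fresh vertex** (both forms at once, by induction on `A`): for `u` met by no pair of `ω`, `u ∉ A`:
(i) for `y, z ≠ u`: `y ↔ z` in `ω ∪ star u A` iff `y ↔ z` in `ω` or `∃ x x' ∈ A`, `y ↔ x` and `x' ↔ z` in `ω`;
(ii) for `y ≠ u`: `y ↔ u` in `ω ∪ star u A` iff `∃ x ∈ A`, `y ↔ x` in `ω`. [folklore] -/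
theorem reachable_union_star (ω : Finset (Sym2 V)) {u : V} (hu : ∀ e ∈ ω, u ∉ e) (A : Finset V) (huA : u ∉ A) :
    (∀ y z : V, y ≠ u → z ≠ u →
      ((openGraph (↑(ω ∪ star u A) : BondConfig V)).Reachable y z ↔
        (openGraph (↑ω : BondConfig V)).Reachable y z ∨
          ∃ x ∈ A, ∃ x' ∈ A, (openGraph (↑ω : BondConfig V)).Reachable y x ∧ (openGraph (↑ω : BondConfig V)).Reachable x' z)) ∧
    (∀ y : V, y ≠ u →
      ((openGraph (↑(ω ∪ star u A) : BondConfig V)).Reachable y u ↔ ∃ x ∈ A, (openGraph (↑ω : BondConfig V)).Reachable y x)) := by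
  induction A using Finset.induction_on with
  | empty =>
    refine ⟨fun y z _ _ => ?_, fun y hy => ?_⟩
    · simp [star]
    · simp only [star_empty, Finset.union_empty, Finset.notMem_empty, false_and, exists_false, iff_false]
      exact Wheel.not_reachable_of_fresh hu hy
  | insert x A hxA ih =>
    have hux : u ≠ x := fun h => huA (h ▸ Finset.mem_insert_self x A)
    have huA' : u ∉ A := fun h => huA (Finset.mem_insert_of_mem h)
    obtain ⟨ih1, ih2⟩ := ih huA'
    -- abbreviations
    have key : ∀ y z : V, (openGraph (↑(ω ∪ star u (insert x A)) : BondConfig V)).Reachable y z ↔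
        (openGraph (↑(ω ∪ star u A) : BondConfig V)).Reachable y z ∨
          ((openGraph (↑(ω ∪ star u A) : BondConfig V)).Reachable y x ∧ (openGraph (↑(ω ∪ star u A) : BondConfig V)).Reachable u z) ∨
          ((openGraph (↑(ω ∪ star u A) : BondConfig V)).Reachable y u ∧ (openGraph (↑(ω ∪ star u A) : BondConfig V)).Reachable x z) := by
      intro y z; rw [union_star_insert]; exact Wheel.reachable_coe_insert_iff _ x u y z
    refine ⟨fun y z hy hz => ?_, fun y hy => ?_⟩
    · rw [key, ih1 y z hy hz, ih1 y x hy hux.symm, ih1 x z hux.symm hz]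
      rw [show (openGraph (↑(ω ∪ star u A) : BondConfig V)).Reachable u z ↔ ∃ x' ∈ A, (openGraph (↑ω : BondConfig V)).Reachable z x' from by
            rw [SimpleGraph.reachable_comm]; exact ih2 z hz]
      rw [ih2 y hy]
      constructor
      · rintro (hA | ⟨hyx, x', hx', hzx'⟩ | ⟨⟨x₁, hx₁, hyx₁⟩, hxz⟩)
        · rcases hA with h | ⟨x₁, h1, x₂, h2, hy1, h2z⟩
          · exact Or.inl h
          · exact Or.inr ⟨x₁, Finset.mem_insert_of_mem h1, x₂, Finset.mem_insert_of_mem h2, hy1, h2z⟩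
        · rcases hyx with hyx | ⟨x₁, hx₁, x₂, _, hyx₁, _⟩
          · exact Or.inr ⟨x, Finset.mem_insert_self _ _, x', Finset.mem_insert_of_mem hx', hyx, hzx'.symm⟩
          · exact Or.inr ⟨x₁, Finset.mem_insert_of_mem hx₁, x', Finset.mem_insert_of_mem hx', hyx₁, hzx'.symm⟩
        · rcases hxz with hxz | ⟨_, _, x₂, hx₂, _, hx₂z⟩
          · exact Or.inr ⟨x₁, Finset.mem_insert_of_mem hx₁, x, Finset.mem_insert_self _ _, hyx₁, hxz⟩
          · exact Or.inr ⟨x₁, Finset.mem_insert_of_mem hx₁, x₂, Finset.mem_insert_of_mem hx₂, hyx₁, hx₂z⟩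
      · rintro (h | ⟨x₁, hx₁, x₂, hx₂, hyx₁, hx₂z⟩)
        · exact Or.inl (Or.inl h)
        · rcases Finset.mem_insert.1 hx₁ with h1 | hx₁A <;> rcases Finset.mem_insert.1 hx₂ with h2 | hx₂A
          · subst h1; subst h2; exact Or.inl (Or.inl (hyx₁.trans hx₂z))
          · subst h1; exact Or.inr (Or.inl ⟨Or.inl hyx₁, x₂, hx₂A, hx₂z.symm⟩)
          · subst h2; exact Or.inr (Or.inr ⟨⟨x₁, hx₁A, hyx₁⟩, Or.inl hx₂z⟩)
          · exact Or.inl (Or.inr ⟨x₁, hx₁A, x₂, hx₂A, hyx₁, hx₂z⟩)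
    · rw [key, ih2 y hy, ih1 y x hy hux.symm]
      have huu : (openGraph (↑(ω ∪ star u A) : BondConfig V)).Reachable u u := SimpleGraph.Reachable.refl _
      constructor
      · rintro (⟨x₁, hx₁, h⟩ | ⟨hyx, -⟩ | ⟨⟨x₁, hx₁, hyx₁⟩, -⟩)
        · exact ⟨x₁, Finset.mem_insert_of_mem hx₁, h⟩
        · rcases hyx with hyx | ⟨x₁, hx₁, x₂, _, hyx₁, _⟩
          · exact ⟨x, Finset.mem_insert_self _ _, hyx⟩
          · exact ⟨x₁, Finset.mem_insert_of_mem hx₁, hyx₁⟩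
        · exact ⟨x₁, Finset.mem_insert_of_mem hx₁, hyx₁⟩
      · rintro ⟨x₁, hx₁, hyx₁⟩
        rcases Finset.mem_insert.1 hx₁ with rfl | hx₁A
        · exact Or.inr (Or.inl ⟨Or.inl hyx₁, huu⟩)
        · exact Or.inl ⟨x₁, hx₁A, hyx₁⟩

/-- **Cluster count of one more ray.**  For `u` met by no pair of `ω`, `u ∉ A`, `x ∉ A`, `x ≠ u`: adding the ray `s(x,u)` to `ω ∪ star u A` lowers the
number of open clusters by one if `x` is joined in `ω` to no `x' ∈ A` (in particular if `A = ∅`), and leaves it unchanged otherwise.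
[cite: Grimmett2006, §1.2 eq. (1.1) (p. 4)] -/
theorem clusterCount_union_star_insert (ω : Finset (Sym2 V)) {u : V} (hu : ∀ e ∈ ω, u ∉ e) {A : Finset V} (huA : u ∉ A)
    {x : V} (hxu : x ≠ u) :
    clusterCount (↑(ω ∪ star u (insert x A)) : BondConfig V) (∅ : Set V) +
        (if ∃ x' ∈ A, (openGraph (↑ω : BondConfig V)).Reachable x x' then 0 else 1) =
      clusterCount (↑(ω ∪ star u A) : BondConfig V) (∅ : Set V) := by
  have h := Wheel.clusterCount_insert_free (ω ∪ star u A) x u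
  rw [union_star_insert]
  have hiff : (openGraph (↑(ω ∪ star u A) : BondConfig V)).Reachable x u ↔
      ∃ x' ∈ A, (openGraph (↑ω : BondConfig V)).Reachable x x' := (reachable_union_star ω hu A huA).2 x hxu
  by_cases hr : ∃ x' ∈ A, (openGraph (↑ω : BondConfig V)).Reachable x x'
  · rw [if_pos hr]; rw [if_pos (hiff.2 hr)] at h; exact h
  · rw [if_neg hr]; rw [if_neg (fun h' => hr (hiff.1 h'))] at h; exact h

end ThreeApex

end FK

end Summit.CriticalPhenomena.PercolationContinuityZ3.Theorems
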